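import Literature.NumberTheory.Automorphic.BrandtEichlerLevelUOperators
import Literature.NumberTheory.Automorphic.BrandtMatrixUnitCount
import Literature.NumberTheory.Automorphic.BrandtWeightSymmetry
import HarnessLib

/-!
# Route `RamifiedHeegnerPair`, crux U₁ `LeafRankOneUpperAtThree` (stmt-BirchSwinnertonDyer-26022), line `partnerdescent` —
# the Hecke–Atkin–Lehner twist (HT) from the tree, part 1: filtered Brandt matrices count elements, and Eichler's
# conjugate-ideal bijection `α ↦ n α⁻¹` for FILTERED Brandt matrices

HONEST FRAMING. Theorems only; helper file (`--supports stmt-BirchSwinnertonDyer-26022`); pure algebra over an arbitrary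
ring `D` with `1 ≠ -1` (no number theory, no named fact, no `sorry`); nothing booked; BSD is proved for no curve.
Lead prover bsd-line-rhp-p2 g65, 2026-08-31.

WHY. Skeleton v10 of the line has the stub HECKE-MODULE whose first conjunct (HT) was reduced by ‹…LeafPartnerOrdersHeckeTwist›
(`heckeTwist_of_involution`, g64) to two facts about the `U`-operators `S.uMatrix ℓ = Brandt.matrixWith S.O (IsForward S.O₁ S.O₂ ℓ) ℓ`
(‹BrandtEichlerLevelUOperators›) at the level primes: the twisted adjointness `w_c (U_ℓ)_{c i} = w_i (U_ℓ)_{σ i, σ c}` for the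
Atkin–Lehner involution `σ`, and the column sums. This file is the GLOBAL half of the adjointness: Eichler's proof of the weight
symmetry `w_i T(n)_{ij} = w_j T(n)_{ji}` (‹BrandtMatrixUnitCount› `two_mul_weight_mul_matrix_apply`: `2 w_i T(n)_{ij} = #{α : α I_i ⊆ I_j,
[I_j : α I_i] = n²}`; ‹BrandtWeightSymmetry› `nonempty_equiv_of_nsmul_le`: `α ↦ n α⁻¹`) carried out for the FILTERED Brandt matrices
`Brandt.matrixWith O P n` of ‹BrandtEichlerLevelUOperators›: for predicates `P`, `P'` on (sub-lattice, ambient lattice) with `P'`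
translation invariant and the TRANSPORT `P (α I_i) I_j ↔ P' (n I_j) (α I_i)` along sub-ideals of index `n²`, and under the same
`n`-divisibility input as the unfiltered statement, `w_i T_P(n)_{ij} = w_j T_{P'}(n)_{ji}` (`weight_mul_matrixWith_eq_of_transport`).
The sequel instantiates `P = IsForward O₁ O₂ ℓ`, `P' J I = IsForward O₁ O₂ ℓ (J 𝔔) (I 𝔔)` (`𝔔` the Atkin–Lehner ideal).
[cite: Eichler1973, Ch. II §6 Thm. 2 (17), (21)–(22)] [cite: Voight2021, (41.1.1), 41.1.3]
-/

set_option linter.dupNamespace false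
set_option autoImplicit false

noncomputable section

namespace Summit.BirchSwinnertonDyer.BirchSwinnertonDyer.Theorems.LeafPartnerOrders

open scoped Pointwise
open Literature.NumberTheory.Automorphic Literature.NumberTheory.Automorphic.Brandt

universe u

variable {D : Type u} [Ring D]

/-! ### Filtered Brandt sets count elements: `2 w(O_L I') · #subidealsWith P n I' I = #{α : α I' ⊆ I, [I : α I'] = n², P (α I') I}` -/

/-- **Orbit–stabiliser for a filtered Brandt set.** For lattices `I', I`, an index `n` and ANY predicate `P` on pairs of lattices,
`α ↦ α I'` induces a bijection `{α ∈ Dˣ : α I' ⊆ I, [I : α I'] = n², P (α I') I} ≃ subidealsWith P n I' I × Stab(I')` (the fibre over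
`J = α I'` is the coset `α · Stab(I')`; the filter is a condition on `J` only). Stated as `Nonempty (_ ≃ _)`. [folklore] -/
theorem nonempty_equiv_subidealsWith_prod_stabilizer (P : Submodule ℤ D → Submodule ℤ D → Prop) (n : ℕ)
    (I' I : Submodule ℤ D) :
    Nonempty ({α : Dˣ // α • I' ≤ I ∧ (α • I').toAddSubgroup.relIndex I.toAddSubgroup = n ^ 2 ∧ P (α • I') I} ≃
      (subidealsWith P n I' I × MulAction.stabilizer Dˣ I')) := by
  classical
  set B : Set (Submodule ℤ D) := subidealsWith P n I' I with hB
  have hsec : ∀ J : B, ∃ α : Dˣ, (J : Submodule ℤ D) = α • I' := fun J ↦ J.2.2.2.2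
  choose σ hσ using hsec
  have hback : ∀ (J : B) (u : MulAction.stabilizer Dˣ I'), (σ J * (u : Dˣ)) • I' = (J : Submodule ℤ D) := fun J u ↦ by
    rw [mul_smul, MulAction.mem_stabilizer_iff.mp u.2, ← hσ J]
  let g : B × MulAction.stabilizer Dˣ I' →
      {α : Dˣ // α • I' ≤ I ∧ (α • I').toAddSubgroup.relIndex I.toAddSubgroup = n ^ 2 ∧ P (α • I') I} :=
    fun q ↦ ⟨σ q.1 * (q.2 : Dˣ), by rw [hback]; exact ⟨q.1.2.1, q.1.2.2.1, q.1.2.2.2.1⟩⟩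
  have hg : Function.Bijective g := by
    constructor
    · rintro ⟨J, u⟩ ⟨J', u'⟩ h
      have h1 : σ J * (u : Dˣ) = σ J' * (u' : Dˣ) := congrArg Subtype.val h
      have hJ : J = J' := by
        apply Subtype.ext
        rw [← hback J u, ← hback J' u', h1]
      subst hJ
      have hu : u = u' := Subtype.ext (mul_left_cancel h1)
      rw [hu]
    · rintro ⟨a, ha⟩
      let J : B := ⟨a • I', ha.1, ha.2.1, ha.2.2, a, rfl⟩
      have hu : (σ J)⁻¹ * a ∈ MulAction.stabilizer Dˣ I' := by
        rw [MulAction.mem_stabilizer_iff, mul_smul, inv_smul_eq_iff]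
        exact hσ J
      exact ⟨(J, ⟨(σ J)⁻¹ * a, hu⟩), Subtype.ext (mul_inv_cancel_left _ _)⟩
  exact ⟨(Equiv.ofBijective g hg).symm⟩

/-- `#{α : α I' ⊆ I, [I : α I'] = n², P (α I') I} = #subidealsWith P n I' I · #Stab(I')` (`Nat.card`). [folklore] -/
theorem card_eq_ncard_subidealsWith_mul_card_stabilizer (P : Submodule ℤ D → Submodule ℤ D → Prop) (n : ℕ)
    (I' I : Submodule ℤ D) :
    Nat.card {α : Dˣ // α • I' ≤ I ∧ (α • I').toAddSubgroup.relIndex I.toAddSubgroup = n ^ 2 ∧ P (α • I') I} =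
      (subidealsWith P n I' I).ncard * Nat.card (MulAction.stabilizer Dˣ I') := by
  obtain ⟨e⟩ := nonempty_equiv_subidealsWith_prod_stabilizer P n I' I
  rw [Nat.card_congr e, Nat.card_prod, Nat.card_coe_set_eq]

/-- `2 · w(O_L I') · #subidealsWith P n I' I = #{α : α I' ⊆ I, [I : α I'] = n², P (α I') I}` (`1 ≠ -1` in `D`). [folklore] -/
theorem two_mul_unitIndex_mul_ncard_subidealsWith (hne : (1 : D) ≠ -1) (P : Submodule ℤ D → Submodule ℤ D → Prop)
    (n : ℕ) (I' I : Submodule ℤ D) :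
    2 * unitIndex (leftOrder I') * (subidealsWith P n I' I).ncard =
      Nat.card {α : Dˣ // α • I' ≤ I ∧ (α • I').toAddSubgroup.relIndex I.toAddSubgroup = n ^ 2 ∧ P (α • I') I} := by
  rw [card_eq_ncard_subidealsWith_mul_card_stabilizer, card_stabilizer_eq_two_mul_unitIndex hne, mul_comm]

/-- **Filtered Brandt matrix entries count elements: `2 w_i · T_P(n)_{ij} = #{α ∈ Dˣ : α I_i ⊆ I_j, [I_j : α I_i] = n², P (α I_i) I_j}`**
on the chosen representatives, for any predicate `P` and any ring with `1 ≠ -1` (‹BrandtMatrixUnitCount› is the case `P = ⊤`).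
[cite: Voight2021, (41.1.1) and 41.1.3] -/
theorem two_mul_weight_mul_matrixWith_apply (hne : (1 : D) ≠ -1) (O : Submodule ℤ D)
    (P : Submodule ℤ D → Submodule ℤ D → Prop) (n : ℕ) (i j : ClassSet O) :
    (2 * weight O i : ℤ) * matrixWith O P n i j =
      Nat.card {α : Dˣ // α • i.rep ≤ j.rep ∧ (α • i.rep).toAddSubgroup.relIndex j.rep.toAddSubgroup = n ^ 2 ∧
        P (α • i.rep) j.rep} := by
  rw [matrixWith_apply, weight, ← two_mul_unitIndex_mul_ncard_subidealsWith hne P n i.rep j.rep]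
  push_cast
  ring

/-! ### Eichler's conjugate-ideal bijection for filtered sets -/

/-- `ν • J = n • J` for the central unit `ν = n · 1`. [folklore] -/
theorem units_smul_eq_natCast_smul_of_val_eq {ν : Dˣ} {n : ℕ} (hν : (ν : D) = (n : ℤ)) (J : Submodule ℤ D) :
    ν • J = ((n : ℕ) : ℤ) • J := by
  ext x
  constructor
  · intro hx
    obtain ⟨y, hy, rfl⟩ := exists_eq_zsmul_of_mem_units_smul hν hx
    exact Submodule.smul_mem_pointwise_smul y _ J hy
  · intro hx
    obtain ⟨y, hy, rfl⟩ := (Submodule.mem_smul_pointwise_iff_exists x _ J).mp hx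
    exact units_smul_eq_zsmul_of_val_eq hν J hy

section Quaternion

variable [Algebra ℚ D] [IsQuaternionAlgebra ℚ D]

/-- **The conjugate-ideal bijection `α ↦ n α⁻¹` between FILTERED sets.** For classes `i, j`, `n ≠ 0`, the `n`-divisibility of
sub-ideals of index `n²` in both directions (as in ‹BrandtWeightSymmetry› `nonempty_equiv_of_nsmul_le`), a translation-invariant `P'`
and the transport `P (α I_i) I_j ↔ P' (n I_j) (α I_i)` along the sub-ideals `α I_i ⊆ I_j` of index `n²`, the map `α ↦ (n·1) α⁻¹` is a
bijection `{α : α I_i ⊆ I_j, [I_j : α I_i] = n², P (α I_i) I_j} ≃ {β : β I_j ⊆ I_i, [I_i : β I_j] = n², P' (β I_j) I_i}`.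
[cite: Eichler1973, Ch. II §6 Thm. 2, (21)–(22)] -/
theorem nonempty_equiv_of_nsmul_le_of_transport {O : Submodule ℤ D} (i j : ClassSet O) {n : ℕ} (hn : n ≠ 0)
    {P P' : Submodule ℤ D → Submodule ℤ D → Prop} (hP' : IsTranslationInvariant P')
    (hij : ∀ α : Dˣ, α • i.rep ≤ j.rep → (α • i.rep).toAddSubgroup.relIndex j.rep.toAddSubgroup = n ^ 2 →
      ∀ y ∈ j.rep, (n : ℤ) • y ∈ α • i.rep)
    (hji : ∀ β : Dˣ, β • j.rep ≤ i.rep → (β • j.rep).toAddSubgroup.relIndex i.rep.toAddSubgroup = n ^ 2 →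
      ∀ y ∈ i.rep, (n : ℤ) • y ∈ β • j.rep)
    (htr : ∀ α : Dˣ, α • i.rep ≤ j.rep → (α • i.rep).toAddSubgroup.relIndex j.rep.toAddSubgroup = n ^ 2 →
      (P (α • i.rep) j.rep ↔ P' (((n : ℕ) : ℤ) • j.rep) (α • i.rep))) :
    Nonempty ({α : Dˣ // α • i.rep ≤ j.rep ∧ (α • i.rep).toAddSubgroup.relIndex j.rep.toAddSubgroup = n ^ 2 ∧
        P (α • i.rep) j.rep} ≃
      {β : Dˣ // β • j.rep ≤ i.rep ∧ (β • j.rep).toAddSubgroup.relIndex i.rep.toAddSubgroup = n ^ 2 ∧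
        P' (β • j.rep) i.rep}) := by
  obtain ⟨ν, hν, hcomm⟩ := exists_units_val_eq_natCast (D := D) hn
  have hIi : IsFullLattice D i.rep := i.rep_mem.1
  have hIj : IsFullLattice D j.rep := j.rep_mem.1
  -- the one-directional construction, for any pair of lattices (as in ‹BrandtWeightSymmetry›)
  have key : ∀ {Ii Ij : Submodule ℤ D}, IsFullLattice D Ij → ∀ {α : Dˣ}, α • Ii ≤ Ij →
      (α • Ii).toAddSubgroup.relIndex Ij.toAddSubgroup = n ^ 2 → (∀ y ∈ Ij, (n : ℤ) • y ∈ α • Ii) →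
        (ν * α⁻¹) • Ij ≤ Ii ∧ ((ν * α⁻¹) • Ij).toAddSubgroup.relIndex Ii.toAddSubgroup = n ^ 2 := by
    intro Ii Ij hIj' α hle hidx hst
    have hstar : ν • Ij ≤ α • Ii := fun x hx ↦ by
      obtain ⟨y, hy, rfl⟩ := exists_eq_zsmul_of_mem_units_smul hν hx
      exact hst y hy
    refine ⟨?_, relIndex_conj_eq_sq hIj' hn hν hcomm hle hidx hstar⟩
    rw [← Brandt.units_smul_le_units_smul_iff α, smul_conj_smul (hcomm α)]
    exact hstar
  have hinv : ∀ a : Dˣ, ν * (ν * a⁻¹)⁻¹ = a := fun a ↦ by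
    rw [mul_inv_rev, inv_inv, ← mul_assoc, ← hcomm a, mul_inv_cancel_right]
  -- the filter along the bijection: `P' ((ν α⁻¹) I_j) I_i ↔ P' (n I_j) (α I_i) ↔ P (α I_i) I_j`
  have hνeq : ∀ α : Dˣ, (ν * α⁻¹) • j.rep = α⁻¹ • ((((n : ℕ) : ℤ)) • j.rep) := fun α ↦ by
    rw [← hcomm, mul_smul, units_smul_eq_natCast_smul_of_val_eq hν]
  have hfilt : ∀ α : Dˣ, α • i.rep ≤ j.rep → (α • i.rep).toAddSubgroup.relIndex j.rep.toAddSubgroup = n ^ 2 →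
      (P (α • i.rep) j.rep ↔ P' ((ν * α⁻¹) • j.rep) i.rep) := fun α hle hidx ↦ by
    rw [htr α hle hidx, hνeq, ← hP' α (α⁻¹ • ((((n : ℕ) : ℤ)) • j.rep)) i.rep, smul_inv_smul]
  refine ⟨{ toFun := fun a ↦ ⟨ν * a.1⁻¹, (key hIj a.2.1 a.2.2.1 (hij a.1 a.2.1 a.2.2.1)).1,
              (key hIj a.2.1 a.2.2.1 (hij a.1 a.2.1 a.2.2.1)).2, (hfilt a.1 a.2.1 a.2.2.1).mp a.2.2.2⟩
            invFun := fun b ↦ ⟨ν * b.1⁻¹, (key hIi b.2.1 b.2.2.1 (hji b.1 b.2.1 b.2.2.1)).1,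
              (key hIi b.2.1 b.2.2.1 (hji b.1 b.2.1 b.2.2.1)).2, ?_⟩
            left_inv := fun a ↦ Subtype.ext (hinv a.1)
            right_inv := fun b ↦ Subtype.ext (hinv b.1) }⟩
  -- the filter in the inverse direction: with `α = ν β⁻¹` one has `ν α⁻¹ = β`
  have h := key hIi b.2.1 b.2.2.1 (hji b.1 b.2.1 b.2.2.1)
  rw [hfilt (ν * b.1⁻¹) h.1 h.2, hinv]
  exact b.2.2.2

/-- **Weight symmetry between two FILTERED Brandt matrices (Eichler's argument with a transported filter).** For an order datum `O` in a
quaternion algebra `D` over `ℚ` (where `1 ≠ -1`), classes `i, j`, an index `n ≠ 0`, predicates `P`, `P'` with `P'` translation invariant, the `n`-divisibility of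
sub-ideals of index `n²` between the representatives (both directions) and the transport `P (α I_i) I_j ↔ P' (n I_j) (α I_i)`:
`w_i · T_P(n)_{ij} = w_j · T_{P'}(n)_{ji}`. [cite: Eichler1973, Ch. II §6 Thm. 2 eq. (17)] -/
theorem weight_mul_matrixWith_eq_of_transport (O : Submodule ℤ D) {n : ℕ} (hn : n ≠ 0) (i j : ClassSet O)
    {P P' : Submodule ℤ D → Submodule ℤ D → Prop} (hP' : IsTranslationInvariant P')
    (hij : ∀ α : Dˣ, α • i.rep ≤ j.rep → (α • i.rep).toAddSubgroup.relIndex j.rep.toAddSubgroup = n ^ 2 →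
      ∀ y ∈ j.rep, (n : ℤ) • y ∈ α • i.rep)
    (hji : ∀ β : Dˣ, β • j.rep ≤ i.rep → (β • j.rep).toAddSubgroup.relIndex i.rep.toAddSubgroup = n ^ 2 →
      ∀ y ∈ i.rep, (n : ℤ) • y ∈ β • j.rep)
    (htr : ∀ α : Dˣ, α • i.rep ≤ j.rep → (α • i.rep).toAddSubgroup.relIndex j.rep.toAddSubgroup = n ^ 2 →
      (P (α • i.rep) j.rep ↔ P' (((n : ℕ) : ℤ) • j.rep) (α • i.rep))) :
    (weight O i : ℤ) * matrixWith O P n i j = (weight O j : ℤ) * matrixWith O P' n j i := by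
  have h1 := two_mul_weight_mul_matrixWith_apply one_ne_neg_one_rat O P n i j
  have h2 := two_mul_weight_mul_matrixWith_apply one_ne_neg_one_rat O P' n j i
  obtain ⟨e⟩ := nonempty_equiv_of_nsmul_le_of_transport i j hn hP' hij hji htr
  have hcard : (Nat.card {α : Dˣ // α • i.rep ≤ j.rep ∧ (α • i.rep).toAddSubgroup.relIndex j.rep.toAddSubgroup = n ^ 2 ∧
      P (α • i.rep) j.rep} : ℤ) =
      Nat.card {β : Dˣ // β • j.rep ≤ i.rep ∧ (β • j.rep).toAddSubgroup.relIndex i.rep.toAddSubgroup = n ^ 2 ∧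
        P' (β • j.rep) i.rep} := by
    exact_mod_cast Nat.card_congr e
  have h : (2 : ℤ) * ((weight O i : ℤ) * matrixWith O P n i j) = 2 * ((weight O j : ℤ) * matrixWith O P' n j i) := by
    rw [← mul_assoc, ← mul_assoc, h1, h2, hcard]
  exact mul_left_cancel₀ two_ne_zero h

end Quaternion

end Summit.BirchSwinnertonDyer.BirchSwinnertonDyer.Theorems.LeafPartnerOrders

end
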